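import Literature.AnabelianGeometry.AbsoluteAnabelian.AbsTopIThm17iProofs
import Literature.AnabelianGeometry.AbsoluteAnabelian.FreeProcyclicModel
import Literature.AlgebraicGeometry.Motives.ZetaFunctionProofs
import Mathlib.FieldTheory.Finite.GaloisField
import Mathlib.FieldTheory.KrullTopology
import HarnessLib

/-!
# [AbsTopI] Thm 1.7 (i) at `G_k` itself: for a finite field `k`, `G_k ≅ Ẑ` is free procyclic,
# hence neither elastic nor slim

S. Mochizuki, *Topics in Absolute Anabelian Geometry I: Generalities* (2012) [AbsTopI] (lit key
`paper:url-11ac98ba15fc`), Thm 1.7 (i) p. 14: "If `k` is an FF, then `G_k ≅ Ẑ` is neither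
elastic nor slim."  The tree's `AbsTopIThm17iProofs` (`thm17i`) proves both clauses for the
INTERFACE predicate "`≅ Ẑ`" (`FundamentalExtension.IsFreeProcyclic`: a dense cyclic subgroup and an
open subgroup of every positive index) and records that "the identification `G_k ≅ Ẑ` for a
finite field `k` is the standard input under which this is the printed (i)" — not proved there.

THIS PROOF-ONLY FILE (no definitions, no named facts) supplies that standard input over the REAL
objects (Serre, *Local Fields*, Ch. XIII §2, Example a): "`ν ↦ F^ν` is an isomorphism
`Ẑ ≅ G(k_s/k)`", `F` the Frobenius substitution `x ↦ x^q`):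

* `isFreeProcyclic_algEquiv_of_isAlgClosure` — for a finite field `K` with `q` elements and an
  algebraic closure `L` of `K`, the Galois group `Gal(L/K)` is free procyclic: the powers of the
  Frobenius `x ↦ x^q` are DENSE (tree `denseRange_zpow_frobeniusAlgEquivOfAlgebraic`, BY NAME),
  and for every `n ≥ 1` the fixed field `K_n` of `Frob^n` — the set of roots of the separable
  polynomial `X^{q^n} − X`, which has exactly `q^n` of them in `L` — has `[K_n : K] = n`
  (`#K_n = q^{[K_n : K]}`), so `Gal(L/K_n)` is an OPEN subgroup of index `n`
  (Mathlib `IntermediateField.fixingSubgroup_isOpen` / `finrank_eq_fixingSubgroup_index`);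
* `isFreeProcyclic_absoluteGaloisGroup_of_finite` — the same for Mathlib's
  `Field.absoluteGaloisGroup k = Gal(k̄/k)`;
* `thm17i_finiteField` — **[AbsTopI] Thm 1.7 (i) UNCONDITIONALLY at `G_k`**: for a finite field
  `k`, `Gal(k̄/k)` is neither elastic nor slim (`thm17i`, BY NAME).

Classical (Serre, *Local Fields* XIII §2; textbook finite-field theory); nothing here bears on
[IUTchIII] Cor. 3.12 or takes a side.
-/

noncomputable section

open Polynomial

universe u

namespace Literature.AnabelianGeometry.AbsoluteAnabelian

open Literature.AlgebraicGeometry.Frobenioids (IsSlimGroup)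

/-! ### The degree-`n` subextension of an algebraic closure of a finite field -/

section FiniteField

variable (K L : Type*) [Field K] [Fintype K] [Field L] [Algebra K L] [IsAlgClosure K L]

/-- For a finite field `K` with `q` elements, an algebraic closure `L` of `K` and `n ≥ 1`, the
fixed field of the `n`-th power of the Frobenius `x ↦ x^q` in `L` is exactly the set of roots of
`X^{q^n} − X` (Serre, *Local Fields* XIII §2: "the cyclic extensions `k_n` consisting of the
elements fixed by `F^n`"). [cite: SerreLocalFields1979, Ch. XIII §2, Example a)] -/
theorem coe_fixedField_zpowers_frobenius_pow {n : ℕ} (hn : n ≠ 0) :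
    ((IntermediateField.fixedField
        (Subgroup.zpowers (FiniteField.frobeniusAlgEquivOfAlgebraic K L ^ n)) :
          IntermediateField K L) : Set L) =
      (X ^ Fintype.card K ^ n - X : L[X]).rootSet L := by
  set φ := FiniteField.frobeniusAlgEquivOfAlgebraic K L with hφ
  have hq : 1 < Fintype.card K := Fintype.one_lt_card
  have hP0 : (X ^ Fintype.card K ^ n - X : L[X]) ≠ 0 :=
    FiniteField.X_pow_card_pow_sub_X_ne_zero L hn hq
  ext x
  rw [SetLike.mem_coe, IntermediateField.mem_fixedField_iff, mem_rootSet_of_ne hP0]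
  simp only [map_sub, map_pow, aeval_X, sub_eq_zero]
  have hpow : (φ ^ n) x = x ^ Fintype.card K ^ n := by
    rw [AlgEquiv.coe_pow, hφ, FiniteField.coe_frobeniusAlgEquivOfAlgebraic_iterate]
  constructor
  · intro h
    rw [← hpow]
    exact h _ (Subgroup.mem_zpowers _)
  · intro h f hf
    have hstab : φ ^ n ∈ MulAction.stabilizer (L ≃ₐ[K] L) x := by
      rw [MulAction.mem_stabilizer_iff, AlgEquiv.smul_def, hpow, h]
    have hle : Subgroup.zpowers (φ ^ n) ≤ MulAction.stabilizer (L ≃ₐ[K] L) x :=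
      (Subgroup.zpowers_le).mpr hstab
    have := hle hf
    rwa [MulAction.mem_stabilizer_iff, AlgEquiv.smul_def] at this

/-- The fixed field `K_n` of `Frob^n` (`n ≥ 1`) in an algebraic closure of the finite field `K`
has exactly `q^n` elements: `X^{q^n} − X` is separable (its derivative is `−1`) and splits in `L`.
[cite: SerreLocalFields1979, Ch. XIII §2, Example a)] -/
theorem natCard_fixedField_zpowers_frobenius_pow {n : ℕ} (hn : n ≠ 0) :
    Nat.card (IntermediateField.fixedField
        (Subgroup.zpowers (FiniteField.frobeniusAlgEquivOfAlgebraic K L ^ n)) :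
          IntermediateField K L) = Fintype.card K ^ n := by
  classical
  haveI : IsAlgClosed L := IsAlgClosure.isAlgClosed K
  have hq : 1 < Fintype.card K := Fintype.one_lt_card
  set E : IntermediateField K L := IntermediateField.fixedField
    (Subgroup.zpowers (FiniteField.frobeniusAlgEquivOfAlgebraic K L ^ n)) with hE
  have hset := coe_fixedField_zpowers_frobenius_pow K L hn
  -- the characteristic of `L` divides `q ^ n`
  have hchar : ringChar L ∣ Fintype.card K ^ n := by
    refine dvd_pow ?_ hn
    -- `ringChar L ∣ q ↔ (q : L) = 0`
    have h0 := congrArg (algebraMap K L) (FiniteField.cast_card_eq_zero K)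
    rw [map_natCast, map_zero] at h0
    exact (ringChar.spec L _).mp h0
  haveI : CharP L (ringChar L) := ringChar.charP L
  have hsep : (X ^ Fintype.card K ^ n - X : L[X]).Separable :=
    galois_poly_separable (ringChar L) _ hchar
  have hcard : Fintype.card ((X ^ Fintype.card K ^ n - X : L[X]).rootSet L) =
      Fintype.card K ^ n := by
    rw [card_rootSet_eq_natDegree hsep (IsAlgClosed.splits _)]
    exact FiniteField.X_pow_card_pow_sub_X_natDegree_eq L hn hq
  rw [← hcard, ← Nat.card_eq_fintype_card]
  exact Nat.card_congr (Equiv.setCongr hset)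

/-- `[K_n : K] = n` for the fixed field `K_n` of `Frob^n` (`n ≥ 1`): `#K_n = q^{[K_n : K]}` and
`#K_n = q^n`. [cite: SerreLocalFields1979, Ch. XIII §2, Example a)] -/
theorem finrank_fixedField_zpowers_frobenius_pow {n : ℕ} (hn : n ≠ 0) :
    Module.finrank K (IntermediateField.fixedField
        (Subgroup.zpowers (FiniteField.frobeniusAlgEquivOfAlgebraic K L ^ n)) :
          IntermediateField K L) = n := by
  have hq : 1 < Fintype.card K := Fintype.one_lt_card
  set E : IntermediateField K L := IntermediateField.fixedField
    (Subgroup.zpowers (FiniteField.frobeniusAlgEquivOfAlgebraic K L ^ n)) with hE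
  have hcardE : Nat.card E = Fintype.card K ^ n := natCard_fixedField_zpowers_frobenius_pow K L hn
  haveI : Finite E := Nat.finite_of_card_ne_zero
    (by rw [hcardE]; exact pow_ne_zero _ (by omega))
  have h := Module.natCard_eq_pow_finrank (K := K) (V := E)
  rw [hcardE, Nat.card_eq_fintype_card] at h
  exact (Nat.pow_right_injective (le_refl 2 |>.trans hq) h).symm

end FiniteField

/-! ### `Gal(L/K) ≅ Ẑ` for an algebraic closure `L` of a finite field `K` -/

/-- **`Gal(K̄/K) ≅ Ẑ` for a finite field `K`** (free procyclic in the sense of the tree's interface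
predicate): for an algebraic closure `L` of `K`, the powers of the Frobenius `x ↦ x^q` are dense in
`Gal(L/K)` and, for every `n ≥ 1`, `Gal(L/K_n)` (`K_n` the fixed field of `Frob^n`, of degree `n`)
is an open subgroup of index `n` (Serre, *Local Fields* XIII §2, Example a): "`ν ↦ F^ν` is an
isomorphism `Ẑ ≅ G(k_s/k)`"). [cite: SerreLocalFields1979, Ch. XIII §2, Example a)] -/
theorem isFreeProcyclic_algEquiv_of_isAlgClosure (K L : Type*) [Field K] [Finite K] [Field L]
    [Algebra K L] [IsAlgClosure K L] :
    FundamentalExtension.IsFreeProcyclic (L ≃ₐ[K] L) := by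
  letI : Fintype K := Fintype.ofFinite K
  haveI : IsGalois K L := IsSepClosure.isGalois
  set φ := FiniteField.frobeniusAlgEquivOfAlgebraic K L with hφ
  refine ⟨⟨φ, ?_⟩, fun n hn => ?_⟩
  · -- density of the Frobenius powers (tree, BY NAME)
    have hd := Literature.AlgebraicGeometry.Motives.denseRange_zpow_frobeniusAlgEquivOfAlgebraic K L
    rw [Subgroup.coe_zpowers]
    exact hd
  · set E : IntermediateField K L :=
      IntermediateField.fixedField (Subgroup.zpowers (φ ^ n)) with hE
    have hfin : Module.finrank K E = n := finrank_fixedField_zpowers_frobenius_pow K L hn.ne'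
    haveI : FiniteDimensional K E := Module.finite_of_finrank_pos (by omega)
    refine ⟨E.fixingSubgroup, IntermediateField.fixingSubgroup_isOpen E, ?_⟩
    rw [← IntermediateField.finrank_eq_fixingSubgroup_index, hfin]

/-- **`G_k = Gal(k̄/k) ≅ Ẑ` for a finite field `k`**: Mathlib's absolute Galois group
`Field.absoluteGaloisGroup k` of a finite field is free procyclic (dense Frobenius powers; an open
subgroup of every positive index). [cite: SerreLocalFields1979, Ch. XIII §2, Example a)] -/
theorem isFreeProcyclic_absoluteGaloisGroup_of_finite (k : Type u) [Field k] [Finite k] :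
    FundamentalExtension.IsFreeProcyclic (Field.absoluteGaloisGroup k) :=
  isFreeProcyclic_algEquiv_of_isAlgClosure k (AlgebraicClosure k)

/-- The arithmetic Frobenius `φ = arithFrob k` (`x ↦ x^q` on `k̄`) is a dense (topological)
generator of `G_k` witnessing the first clause (tree `denseRange_zpowers_arithFrob_holds`, BY NAME).
[cite: SerreLocalFields1979, Ch. XIII §1] -/
theorem dense_zpowers_arithFrob (k : Type u) [Field k] [Finite k] :
    Dense (Subgroup.zpowers (Literature.AlgebraicGeometry.Motives.arithFrob k) :
      Set (Field.absoluteGaloisGroup k)) := by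
  rw [Subgroup.coe_zpowers]
  exact Literature.AlgebraicGeometry.Motives.denseRange_zpowers_arithFrob_holds (k := k)

/-! ### [AbsTopI] Thm 1.7 (i) at `G_k` -/

/-- **[AbsTopI] Thm 1.7 (i)**, unconditionally at the real object: "If `k` is an FF, then
`G_k ≅ Ẑ` is neither elastic nor slim" — for a finite field `k`, `Gal(k̄/k)` is neither elastic nor
slim (`thm17i` for the interface `IsFreeProcyclic`, fed with
`isFreeProcyclic_absoluteGaloisGroup_of_finite`; compactness of `Gal(k̄/k)` because `k̄/k` is
Galois, `k` being perfect). [cite: MochizukiAbsTopI2012, Thm 1.7 (i) p.14] -/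
theorem thm17i_finiteField (k : Type u) [Field k] [Finite k] :
    ¬ IsElastic (Field.absoluteGaloisGroup k) ∧ ¬ IsSlimGroup (Field.absoluteGaloisGroup k) := by
  haveI : IsGalois k (AlgebraicClosure k) := IsSepClosure.isGalois
  haveI : CompactSpace (Field.absoluteGaloisGroup k) :=
    inferInstanceAs <| CompactSpace (AlgebraicClosure k ≃ₐ[k] AlgebraicClosure k)
  exact thm17i (isFreeProcyclic_absoluteGaloisGroup_of_finite k)

end Literature.AnabelianGeometry.AbsoluteAnabelian

end
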